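import Literature.Barriers.PneNP.TSPExtensionComplexityHubGadgetTours
import Literature.Barriers.PneNP.TSPExtensionComplexityPMPolytope
import Literature.Barriers.PneNP.TSPExtensionComplexityFaces
import Mathlib.LinearAlgebra.Pi
import HarnessLib

/-!
# The perfect matching polytope is a projection of a face of the TSP polytope

Support file for the discharge of `Literature.Barriers.PneNP.Rothvoss2017_tsp`: the step
"Yannakakis' paper also describes a linear projection from a face of the TSP polytope in an
`O(n)`-node graph to the perfect matching polytope in an `n`-node graph. This immediately
implies a lower bound for TSP as well" (Rothvoß 2017, §1.1, PDF p. 4), carried out with the hub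
gadget of `…HubGadget.lean` / `…HubGadgetTours.lean` on `N = 2n + h + s` cities (`n = 2h ≥ 1`,
any `s`):

* `hvEquiv`, `vmap`, `emap` — relabel the gadget vertices as `Fin N`, embed the originals, and
  the induced map on edge coordinates `E(K_n) → E(K_N)`;
* `tspFace n h s = TSP(N) ∩ {x_e = 0 for every non-gadget edge e}` (a face: these are valid
  equalities `x_e ≥ 0` turned tight);
* `image_tspFace_eq_pmPolytope` — restricting the points of that face to the `v–v`
  coordinates gives EXACTLY `P_PM(n)`: tours inside the gadget trace perfect matchings
  (`existsUnique_vv`) and every perfect matching is traced (`exists_tour_of_mate`), and both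
  sets are the convex hulls of these `0/1` points;
* `hasEF_pmPolytope_of_tsp` — hence an EF of `TSP(N)` with `r` inequalities yields one of
  `P_PM(n)` with `|E(K_N)| + r` inequalities (`…Faces.lean`: faces are free, the coordinate
  projection costs `|E(K_N)|` sign constraints in slack form).

All [folklore] glue around the cited statement.
-/

noncomputable section

open scoped Classical

namespace Literature.Barriers.PneNP

open Finset Matrix HV

variable {n h s : ℕ}

/-! ### Relabelling and the coordinate map -/

/-- The gadget vertices relabelled as `Fin (2n + h + s)`. [folklore] -/
def hvEquiv (n h s : ℕ) : HV n h s ≃ Fin (2 * n + h + s) :=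
  Fintype.equivFinOfCardEq (HV.card n h s)

/-- The city of the original vertex `i`. [folklore] -/
def vmap (n h s : ℕ) (i : Fin n) : Fin (2 * n + h + s) := hvEquiv n h s (v i)

/-- `vmap` is injective. [folklore] -/
theorem vmap_injective (n h s : ℕ) : Function.Injective (vmap n h s) := by
  intro i j hij
  have := (hvEquiv n h s).injective hij
  simpa using this

/-- Edges of the complete graph are the non-diagonal pairs. [folklore] -/
theorem mem_edgeSet_top_iff {V : Type*} {e : Sym2 V} : e ∈ (⊤ : SimpleGraph V).edgeSet ↔ ¬e.IsDiag := by
  induction e using Sym2.ind with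
  | h a b => simp

/-- The induced map on edge coordinates `E(K_n) → E(K_N)`. [folklore] -/
def emap (n h s : ℕ) (ε : (⊤ : SimpleGraph (Fin n)).edgeSet) :
    (⊤ : SimpleGraph (Fin (2 * n + h + s))).edgeSet :=
  ⟨Sym2.map (vmap n h s) ε, mem_edgeSet_top_iff.2 (by
    rw [Sym2.isDiag_map (vmap_injective n h s)]
    exact mem_edgeSet_top_iff.1 ε.2)⟩

/-- `emap` on a pair. [folklore] -/
theorem emap_mk {i j : Fin n} (hij : s(i, j) ∈ (⊤ : SimpleGraph (Fin n)).edgeSet) :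
    ((emap n h s ⟨s(i, j), hij⟩ : (⊤ : SimpleGraph (Fin (2 * n + h + s))).edgeSet) :
      Sym2 (Fin (2 * n + h + s))) = Sym2.map (hvEquiv n h s) s(v i, v j) := by
  simp [emap, vmap]

/-- The non-gadget edge coordinates of `K_N`. [folklore] -/
def outCoords (n h s : ℕ) : Finset (⊤ : SimpleGraph (Fin (2 * n + h + s))).edgeSet :=
  univ.filter fun ε => Sym2.map (hvEquiv n h s).symm (ε : Sym2 (Fin (2 * n + h + s))) ∉
    (hubGadget n h s).edgeSet

/-- **The face of `TSP(N)` of tours inside the gadget**: `x_e = 0` for every non-gadget edge.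
[cite: Rothvoss2017, §1.1 (PDF p. 4)] -/
def tspFace (n h s : ℕ) : Set ((⊤ : SimpleGraph (Fin (2 * n + h + s))).edgeSet → ℝ) :=
  tspPolytope (2 * n + h + s) ∩
    {x | ∀ t : {ε // ε ∈ outCoords n h s},
      Pi.single (t : (⊤ : SimpleGraph (Fin (2 * n + h + s))).edgeSet) (1 : ℝ) ⬝ᵥ x = 0}

/-- Membership in the face: in `TSP(N)` and vanishing on the non-gadget coordinates.
[folklore] -/
theorem mem_tspFace_iff {x : (⊤ : SimpleGraph (Fin (2 * n + h + s))).edgeSet → ℝ} :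
    x ∈ tspFace n h s ↔ x ∈ tspPolytope (2 * n + h + s) ∧ ∀ ε ∈ outCoords n h s, x ε = 0 := by
  simp only [tspFace, Set.mem_inter_iff, Set.mem_setOf_eq, single_dotProduct, one_mul,
    Subtype.forall]

/-! ### Perfect matchings as involutions -/

section mate

variable {M : Finset (Sym2 (Fin n))} (hM : IsPMOn univ M)
include hM

/-- The partner map of a perfect matching of `K_n`. [folklore] -/
def mateOf (i : Fin n) : Fin n :=
  Sym2.Mem.other (Classical.choose_spec (hM.exists_mem (mem_univ i))).2

/-- `{i, mate i} ∈ M`. [folklore] -/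
theorem mk_mateOf_mem (i : Fin n) : s(i, mateOf hM i) ∈ M := by
  unfold mateOf
  rw [Sym2.other_spec]
  exact (Classical.choose_spec (hM.exists_mem (mem_univ i))).1

/-- The partner is the only neighbour. [folklore] -/
theorem eq_mateOf_of_mem {i j : Fin n} (hij : s(i, j) ∈ M) : j = mateOf hM i := by
  have := hM.unique hij (mk_mateOf_mem hM i) (Sym2.mem_mk_left _ _) (Sym2.mem_mk_left _ _)
  exact Sym2.congr_right.1 this

/-- `mate` is an involution … [folklore] -/
theorem mateOf_mateOf (i : Fin n) : mateOf hM (mateOf hM i) = i := by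
  refine (eq_mateOf_of_mem hM ?_).symm
  rw [Sym2.eq_swap]
  exact mk_mateOf_mem hM i

/-- … without fixed points. [folklore] -/
theorem mateOf_ne (i : Fin n) : mateOf hM i ≠ i := by
  intro h0
  have := mk_mateOf_mem hM i
  rw [h0] at this
  exact hM.not_isDiag this (by simp)

/-- Membership in `M` through `mate`. [folklore] -/
theorem mem_iff_mateOf {i j : Fin n} : s(i, j) ∈ M ↔ j = mateOf hM i :=
  ⟨eq_mateOf_of_mem hM, fun h0 => h0 ▸ mk_mateOf_mem hM i⟩

end mate

/-! ### Tours inside the gadget trace perfect matchings -/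

section trace

variable {F : Finset (Sym2 (HV n h s))} (hF : IsTourOn F)
  (hFG : ∀ e ∈ F, e ∈ (hubGadget n h s).edgeSet) (hhn : 2 * h = n) (hn : 0 < n)
include hF hFG hhn hn

/-- The `v–v` partner map of a tour inside the gadget. [folklore] -/
def tourMate (i : Fin n) : Fin n := Classical.choose (existsUnique_vv hn hF hFG hhn i).exists

/-- `{v i, v (tourMate i)} ∈ F`. [folklore] -/
theorem mk_tourMate_mem (i : Fin n) : s(v i, v (tourMate hF hFG hhn hn i)) ∈ F :=
  Classical.choose_spec (existsUnique_vv hn hF hFG hhn i).exists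

/-- The partner is the only `v–v` neighbour. [folklore] -/
theorem eq_tourMate_of_mem {i j : Fin n} (hij : s(v i, v j) ∈ F) : j = tourMate hF hFG hhn hn i :=
  (existsUnique_vv hn hF hFG hhn i).unique hij (mk_tourMate_mem hF hFG hhn hn i)

/-- Membership through `tourMate`. [folklore] -/
theorem vv_mem_iff_tourMate {i j : Fin n} : s(v i, v j) ∈ F ↔ j = tourMate hF hFG hhn hn i :=
  ⟨eq_tourMate_of_mem hF hFG hhn hn, fun h0 => h0 ▸ mk_tourMate_mem hF hFG hhn hn i⟩

/-- `tourMate` is a fixed-point-free involution. [folklore] -/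
theorem tourMate_tourMate (i : Fin n) : tourMate hF hFG hhn hn (tourMate hF hFG hhn hn i) = i :=
  (eq_tourMate_of_mem hF hFG hhn hn (vv_symm hF (mk_tourMate_mem hF hFG hhn hn i)).1).symm

/-- [folklore] -/
theorem tourMate_ne (i : Fin n) : tourMate hF hFG hhn hn i ≠ i :=
  fun h0 => (vv_symm hF (mk_tourMate_mem hF hFG hhn hn i)).2 h0.symm

/-- The traced perfect matching `{ {i, tourMate i} }`. [folklore] -/
def traceMatching : Finset (Sym2 (Fin n)) := univ.image fun i => s(i, tourMate hF hFG hhn hn i)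

/-- Membership in the trace. [folklore] -/
theorem mem_traceMatching_iff {i j : Fin n} :
    s(i, j) ∈ traceMatching hF hFG hhn hn ↔ j = tourMate hF hFG hhn hn i := by
  simp only [traceMatching, mem_image, mem_univ, true_and, Sym2.eq_iff]
  constructor
  · rintro ⟨i', ⟨rfl, rfl⟩ | ⟨rfl, rfl⟩⟩
    · rfl
    · exact (tourMate_tourMate hF hFG hhn hn i').symm
  · rintro rfl
    exact ⟨i, Or.inl ⟨rfl, rfl⟩⟩

/-- **The trace of a tour inside the gadget is a perfect matching of `K_n`.** [folklore] -/
theorem isPMOn_traceMatching : IsPMOn univ (traceMatching hF hFG hhn hn) := by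
  refine ⟨fun e _ => mem_sym2_iff.2 fun a _ => mem_univ a, ?_, fun i _ => ?_⟩
  · intro e he
    obtain ⟨i, -, rfl⟩ := mem_image.1 he
    rw [Sym2.mk_isDiag_iff]
    exact (tourMate_ne hF hFG hhn hn i).symm
  · rw [card_eq_one]
    refine ⟨s(i, tourMate hF hFG hhn hn i), ?_⟩
    ext e
    simp only [mem_filter, mem_singleton]
    constructor
    · rintro ⟨he, hie⟩
      induction e using Sym2.ind with
      | h a b =>
        rw [mem_traceMatching_iff] at he
        subst he
        rcases Sym2.mem_iff.1 hie with rfl | rfl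
        · rfl
        · rw [tourMate_tourMate, Sym2.eq_swap]
    · rintro rfl
      exact ⟨(mem_traceMatching_iff hF hFG hhn hn).2 rfl, Sym2.mem_mk_left _ _⟩

end trace

/-! ### Transport of edge sets along the relabelling -/

/-- For an edge set `F` of `K_N` pulled back to the gadget, `{v i, v j}` is in the pull-back
iff the corresponding coordinate of `F` is. [folklore] -/
theorem vv_mem_image_symm_iff (F : Finset (Sym2 (Fin (2 * n + h + s)))) (i j : Fin n) :
    s(v i, v j) ∈ F.image (Sym2.map (hvEquiv n h s).symm) ↔
      Sym2.map (hvEquiv n h s) s(v i, v j) ∈ F := by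
  rw [mem_image]
  constructor
  · rintro ⟨e, he, hve⟩
    have : Sym2.map (hvEquiv n h s) (Sym2.map (hvEquiv n h s).symm e) = e := by
      rw [Sym2.map_map, Equiv.self_comp_symm, Sym2.map_id]; rfl
    rw [← hve, this]
    exact he
  · intro hmem
    refine ⟨_, hmem, ?_⟩
    rw [Sym2.map_map, Equiv.symm_comp_self, Sym2.map_id]; rfl

/-- The value of a characteristic vector of `K_N` at the image of the coordinate `{i, j}`.
[folklore] -/
theorem charVec_emap (F : Finset (Sym2 (Fin (2 * n + h + s)))) {i j : Fin n}
    (hij : s(i, j) ∈ (⊤ : SimpleGraph (Fin n)).edgeSet) :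
    charVec F (emap n h s ⟨s(i, j), hij⟩) =
      if s(v i, v j) ∈ F.image (Sym2.map (hvEquiv n h s).symm) then 1 else 0 := by
  unfold charVec
  apply if_congr _ rfl rfl
  rw [emap_mk]
  exact (vv_mem_image_symm_iff F i j).symm

/-! ### The two inclusions -/

/-- **Every perfect matching is traced**: `χ^M = (χ^{T'}) ∘ emap` for a tour `T'` of `K_N`
inside the gadget. [folklore] -/
theorem exists_face_point_of_pm (hhn : 2 * h = n) (hn : 0 < n) {M : Finset (Sym2 (Fin n))}
    (hM : IsPMOn univ M) :
    ∃ y ∈ tspFace n h s, y ∘ emap n h s = charVec M := by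
  obtain ⟨T, hT, hTG, hvv⟩ := exists_tour_of_mate (s := s) hhn hn (mateOf hM) (mateOf_mateOf hM)
    (mateOf_ne hM)
  set T' : Finset (Sym2 (Fin (2 * n + h + s))) := T.image (Sym2.map (hvEquiv n h s)) with hT'
  have htour : IsTourEdgeSet T' := (isTourOn_iff_isTourEdgeSet T').1 (hT.image_equiv _)
  refine ⟨charVec T', ?_, ?_⟩
  · rw [mem_tspFace_iff]
    refine ⟨charVec_mem_tspPolytope htour, fun ε hε => ?_⟩
    rw [outCoords, mem_filter] at hε
    unfold charVec
    rw [if_neg]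
    intro hmem
    obtain ⟨e, he, hee⟩ := mem_image.1 hmem
    apply hε.2
    rw [← hee, Sym2.map_map]
    rw [Equiv.symm_comp_self, Sym2.map_id]
    exact hTG e he
  · funext ε
    obtain ⟨e, he⟩ := ε
    induction e using Sym2.ind with
    | h i j =>
      rw [Function.comp_apply, charVec_emap]
      have hback : T'.image (Sym2.map (hvEquiv n h s).symm) = T := by
        rw [hT', image_image]
        have : (Sym2.map (hvEquiv n h s).symm ∘ Sym2.map (hvEquiv n h s) :
            Sym2 (HV n h s) → Sym2 (HV n h s)) = id := by
          funext e
          rw [Function.comp_apply, Sym2.map_map, Equiv.symm_comp_self, Sym2.map_id]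
        rw [this, image_id]
      unfold charVec
      apply if_congr _ rfl rfl
      rw [hback, hvv i j, ← mem_iff_mateOf hM]

/-- **Every point of the face restricts to a point of `P_PM(n)`.** [folklore] -/
theorem comp_emap_mem_pmPolytope (hhn : 2 * h = n) (hn : 0 < n)
    {x : (⊤ : SimpleGraph (Fin (2 * n + h + s))).edgeSet → ℝ} (hx : x ∈ tspFace n h s) :
    x ∘ emap n h s ∈ pmPolytope n := by
  rw [mem_tspFace_iff, tspPolytope_eq_convexHull_tourVectors] at hx
  obtain ⟨hx, hx0⟩ := hx
  obtain ⟨w, hw0, hw1, hwx⟩ := Finset.mem_convexHull'.1 hx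
  -- tours carrying weight stay inside the gadget
  have hvanish : ∀ y ∈ tourVectors (2 * n + h + s), w y ≠ 0 → ∀ ε ∈ outCoords n h s, y ε = 0 := by
    intro y hy hwy ε hε
    have hsum : ∑ z ∈ tourVectors (2 * n + h + s), w z * z ε = 0 := by
      have := congrFun hwx ε
      simp only [Finset.sum_apply, Pi.smul_apply, smul_eq_mul] at this
      rw [this, hx0 ε hε]
    have hnn : ∀ z ∈ tourVectors (2 * n + h + s), 0 ≤ w z * z ε := by
      intro z hz
      obtain ⟨F, -, rfl⟩ := mem_image.1 hz
      exact mul_nonneg (hw0 _ hz) (charVec_nonneg F ε)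
    have h1 := (sum_eq_zero_iff_of_nonneg hnn).1 hsum y hy
    obtain ⟨F, -, rfl⟩ := mem_image.1 hy
    rcases mul_eq_zero.1 h1 with h2 | h2
    · exact absurd h2 hwy
    · exact h2
  -- each such tour traces a perfect matching
  have htrace : ∀ y ∈ tourVectors (2 * n + h + s), w y ≠ 0 → y ∘ emap n h s ∈ pmPolytope n := by
    intro y hy hwy
    have hy0 := hvanish y hy hwy
    obtain ⟨F, hF, rfl⟩ := mem_image.1 hy
    rw [mem_filter] at hF
    have hFt : IsTourOn F := (isTourOn_iff_isTourEdgeSet F).2 hF.2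
    set F' : Finset (Sym2 (HV n h s)) := F.image (Sym2.map (hvEquiv n h s).symm) with hF'
    have hF't : IsTourOn F' := hFt.image_equiv _
    have hF'G : ∀ e ∈ F', e ∈ (hubGadget n h s).edgeSet := by
      intro e he
      obtain ⟨e₀, he₀, rfl⟩ := mem_image.1 he
      by_contra hout
      have hedge : e₀ ∈ (⊤ : SimpleGraph (Fin (2 * n + h + s))).edgeSet := hFt.mem_edgeSet he₀
      have hmem : (⟨e₀, hedge⟩ : (⊤ : SimpleGraph (Fin (2 * n + h + s))).edgeSet) ∈ outCoords n h s := by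
        rw [outCoords, mem_filter]
        exact ⟨mem_univ _, hout⟩
      have := hy0 _ hmem
      unfold charVec at this
      simp [he₀] at this
    have key : charVec F ∘ emap n h s = charVec (traceMatching hF't hF'G hhn hn) := by
      funext ε
      obtain ⟨e, he⟩ := ε
      induction e using Sym2.ind with
      | h i j =>
        rw [Function.comp_apply, charVec_emap]
        unfold charVec
        apply if_congr _ rfl rfl
        rw [← hF', vv_mem_iff_tourMate hF't hF'G hhn hn, ← mem_traceMatching_iff hF't hF'G hhn hn]
    rw [key]
    exact charVec_mem_pmPolytope (isPMOn_traceMatching hF't hF'G hhn hn)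
  -- restrict the convex combination to the tours carrying weight
  set t := (tourVectors (2 * n + h + s)).filter fun y => w y ≠ 0 with ht
  have hw1' : ∑ y ∈ t, w y = 1 := by rw [ht, sum_filter_ne_zero, hw1]
  have hsum : x ∘ emap n h s = ∑ y ∈ t, w y • (y ∘ emap n h s) := by
    rw [ht, sum_filter_of_ne (fun y _ hwy => by
      intro h0; exact hwy (by rw [h0, zero_smul]) )]
    · rw [← hwx]
      funext ε
      simp only [Function.comp_apply, Finset.sum_apply, Pi.smul_apply, smul_eq_mul]
  rw [hsum]
  refine (convex_convexHull ℝ _).sum_mem (fun y hy => hw0 y (mem_filter.1 hy).1) hw1' ?_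
  intro y hy
  exact htrace y (mem_filter.1 hy).1 (mem_filter.1 hy).2

/-- **`P_PM(n)` is the coordinate projection of the face `tspFace n h s` of `TSP(2n+h+s)`.**
[cite: Rothvoss2017, §1.1 (PDF p. 4)] -/
theorem image_tspFace_eq_pmPolytope (hhn : 2 * h = n) (hn : 0 < n) :
    (fun x => x ∘ emap n h s) '' tspFace n h s = pmPolytope n := by
  apply Set.Subset.antisymm
  · rintro _ ⟨x, hx, rfl⟩
    exact comp_emap_mem_pmPolytope hhn hn hx
  · -- the image is convex and contains the characteristic vectors of perfect matchings
    have hconvF : Convex ℝ (tspFace n h s) := by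
      refine (convex_convexHull ℝ _).inter ?_
      intro x hx y hy a b _ _ _ t
      simp only [Set.mem_setOf_eq] at hx hy ⊢
      rw [dotProduct_add, dotProduct_smul, dotProduct_smul, hx t, hy t, smul_zero, smul_zero,
        add_zero]
    have hconv : Convex ℝ ((fun x => x ∘ emap n h s) '' tspFace n h s) := by
      have : (fun x : (⊤ : SimpleGraph (Fin (2 * n + h + s))).edgeSet → ℝ => x ∘ emap n h s) =
          (LinearMap.funLeft ℝ ℝ (emap n h s) : _ → _) := by
        funext x; rfl
      rw [this]
      exact hconvF.linear_image _
    refine convexHull_min ?_ hconv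
    rintro _ ⟨M, hM, rfl⟩
    obtain ⟨y, hy, hyM⟩ := exists_face_point_of_pm hhn hn hM
    exact ⟨y, hy, hyM⟩

/-- **An EF of `TSP(2n+h+s)` with `r` inequalities yields an EF of `P_PM(n)` with
`|E(K_{2n+h+s})| + r` inequalities** (`n = 2h ≥ 1`).
[cite: Rothvoss2017, §1.1 (PDF p. 4)] -/
theorem hasEF_pmPolytope_of_tsp (hhn : 2 * h = n) (hn : 0 < n) {r : ℕ}
    (hr : HasEFOfSize (tspPolytope (2 * n + h + s)) r) :
    HasEFOfSize (pmPolytope n)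
      (Fintype.card (⊤ : SimpleGraph (Fin (2 * n + h + s))).edgeSet + r) := by
  have hface : HasEFOfSize (tspFace n h s) r := hr.inter_eqs _ _
  have hnonneg : ∀ x ∈ tspFace n h s, ∀ ε, 0 ≤ x ε :=
    fun x hx ε => tspPolytope_nonneg x hx.1 ε
  have := hface.image_comp hnonneg (emap n h s)
  rwa [image_tspFace_eq_pmPolytope hhn hn] at this

end Literature.Barriers.PneNP

end
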